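import Literature.NumberTheory.Automorphic.BCDTModularity
import Literature.NumberTheory.Automorphic.CDTModularityProofs
import Literature.NumberTheory.Automorphic.SerreConjecture
import Literature.NumberTheory.GaloisRepresentations.ModNCyclotomicCharacter
import Literature.NumberTheory.EllipticCurves.NewformsCoeffFieldProofs
import Literature.NumberTheory.EllipticCurves.ModularSymbolsLattice
import HarnessLib

/-!
# BCDT Theorem B is a case of Serre's conjecture (3.2.3): Theorem A from Khare–Wintenberger (proofs)

Topic `NumberTheory/Automorphic`; a `…Proofs` companion (theorems only: no definitions, no named
facts, no instances) of `Literature.NumberTheory.Automorphic.BCDTModularity`, landed by the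
tenured seat of the named fact
`Literature.NumberTheory.Automorphic.exists_cuspForm_coeff_eq_frobeniusTrace` (**lang.S33**,
`LangWave0`).

State of the tree before this file (see `BCDTModularity`, `CDTModularityProofs`,
`LangWave0Proofs`): the Modularity Theorem
(`Literature.NumberTheory.EllipticCurves.ModularForms.exists_isNewformOf` = BCDT Thm. A, hence
lang.S33) is proved from the named facts {`BCDT.theoremB`, `BCDT.CDT_theorem_7_2_4`}, resp.
{`BCDT.theoremB`, `BCDT.CDT_theorem_7_1_2`, `BCDT.CDT_theorem_7_2_2`, Ogg–Saito for `V₅ E`}. The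
*printed* proof of Theorem B (BCDT, J. Amer. Math. Soc. 14 (2001), §2.2, proof of Thm. 2.2.1:
Thms. 1.4.1–1.4.2 = modularity lifting for potentially Barsotti–Tate `3`-adic representations of
prescribed (extended) `3`-type, Lemmas/Thms. 2.1.1–2.1.6, CDT Thm. 7.2.1 and Prop. B.4.2, the
Langlands–Tunnell theorem, the twist of `X(5)` [SBT, §1] with Ekedahl's Hilbert irreducibility and
[Man]) cannot at present even be *stated* in the tree: Mathlib has no `p`-adic Hodge theory
(potentially Barsotti–Tate representations, Weil–Deligne types via Fontaine's `D_pst`), no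
Bushnell–Kutzko types, no Galois deformation rings or Hecke modules ("admits", "weakly
acceptable", BCDT §§1.2–1.3).

What this file adds is the observation printed in BCDT's Introduction (p. 845: "Serre has
conjectured that all odd, irreducible `ρ̄` are strongly modular [Se2]") made into a theorem:
**Theorem B is the `𝔽₅`-rational, cyclotomic-determinant instance of Serre's conjecture in its
weak form** (Serre, Duke Math. J. 54 (1987), (3.2.3); a theorem of Khare–Wintenberger, Invent.
Math. 178 (2009), Thm. 1.2), which the tree vendors as the named fact
`Literature.NumberTheory.Automorphic.exists_newform_of_odd_irreducible` (**lang.S37**, weak form,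
file `SerreConjecture`). Precisely:

* `FramedGaloisRep.IsOdd.baseChange`, `FramedRep.IsAbsolutelyIrreducible.isIrreducible_baseChange`
  (bookkeeping: oddness and irreducibility of a base change `ρ̄ ⊗_{k,j} K`);
* `ModPGaloisRep.isOdd_of_det_eq_modPCyclotomicCharacterZMod`: a mod-`p` representation of `Γ_K`
  with cyclotomic determinant is odd, since `χ̄_p(c) = -1` for every complex conjugation `c`
  (`modNCyclotomicCharacter_of_isComplexConjugation`; Serre 1987 §1.1, §1.4);
* **`BCDT.theoremB_of_exists_newform_of_odd_irreducible`**: Serre (3.2.3) at `p = 5` (for all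
  discrete coefficient fields `k : Type`; the hypotheses `CharP k 5`, `IsAlgClosed k` are premises
  inside the fact) implies `BCDT.theoremB`. Proof: for `ρ̄ : Γ_ℚ → GL₂(𝔽₅)` absolutely
  irreducible with `det ρ̄ = χ̄₅`, the base change `ρ̄ ⊗ 𝔽̄₅` to `k = AlgebraicClosure (ZMod 5)`
  (discrete topology) is irreducible and odd, so (3.2.3) gives a newform `f ∈ S_w(Γ₁(N))` and
  `ι : 𝓞_f → 𝔽̄₅` with `ρ̄ ⊗ 𝔽̄₅` unramified at `q ∤ 5N` and
  `charpoly (ρ̄ ⊗ 𝔽̄₅)(Frob_q) = ι(X² - a_q(f) X + ε(q) q^{w-1})`; this is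
  `ModPGaloisRep.IsModular ρ̄` (BCDT's "`ρ̄` is modular", `BCDTModularity`) with `K = 𝔽̄₅`,
  `j = algebraMap`, once `w ≥ 1` — and `w = 0` is impossible because a newform is non-zero
  (`IsNormalized.ne_zero`) while `S₀(Γ₁(N)) = 0` (`cuspForm_eq_zero_of_weight_nonpos`);
* the corollaries recording the resulting alternative trust bases of Theorem A and of lang.S33:
  `BCDT.exists_isNewformOf_of_serre_of_CDT` ({Serre (3.2.3) at `p = 5`, CDT Thm. 7.2.4}),
  `BCDT.exists_isNewformOf_of_serre_of_CDT712_722` ({Serre (3.2.3) at `p = 5`, CDT Thms. 7.1.2,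
  7.2.2, Ogg–Saito for `V₅ E`}), and
  `exists_cuspForm_coeff_eq_frobeniusTrace_of_serre_of_CDT`,
  `exists_cuspForm_qExpansion_coeff_eq_lFunction_of_serre_of_CDT` (both forms of lang.S33).

This does not shrink the trust base of lang.S33 (Khare–Wintenberger rests on modularity lifting
and potential modularity far beyond BCDT); it records a proved implication between two
acceptance-suite facts of the tree (lang.S37 ⇒ Thm. B ⇒, with CDT 7.2.4, lang.S33) and checks that
the tree's renderings of "`ρ̄` is modular" (`ModPGaloisRep.IsModular`, BCDT Introduction) and of
"`ρ̄` arises from a newform" (`IsGaloisRepOfNewform1Int`, Serre (3.2.3)) are compatible.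

## Faithfulness notes

* Serre (3.2.3)/Khare–Wintenberger is about `ρ̄ : G_ℚ → GL₂(𝔽̄_p)` odd and irreducible; BCDT's
  Theorem B is about `ρ̄ : G_ℚ → GL₂(𝔽₅)` (absolutely) irreducible with cyclotomic determinant.
  "Cyclotomic determinant ⇒ odd" is `χ̄₅(c) = -1 ≠ 1` (`5 ≠ 2`); "absolutely irreducible over
  `𝔽₅`" is by definition (`FramedRep.IsAbsolutelyIrreducible`) irreducibility of every base
  change to a field `B ⊇ 𝔽₅` in `Type`, in particular to `𝔽̄₅ = AlgebraicClosure (ZMod 5)`.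
* The hypothesis of the main theorem is the tree's `exists_newform_of_odd_irreducible` at `p = 5`
  quantified over all discrete coefficient fields `k : Type` (the fact's own binders; its premises
  `[CharP k 5] [IsAlgClosed k]` are inside the `Prop`); only `k = AlgebraicClosure (ZMod 5)` with
  the discrete topology `⊥` is used.
* `ModPGaloisRep.IsModular` allows any weight `w ≥ 1`, level `N ≥ 1` and coefficient extension
  `K ⊇ 𝔽₅`; Serre (3.2.3) provides exactly such data (the strong form (3.2.4), level `N(ρ̄)` and
  weight `k(ρ̄)`, is not needed), with exceptional set `{q ∣ N·5} = {q ∣ N · ringChar 𝔽₅}`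
  (`ZMod.ringChar_zmod_n`).

## References

* [BCDTJAMS2001] C. Breuil, B. Conrad, F. Diamond, R. Taylor, *On the modularity of elliptic
  curves over `ℚ`: wild 3-adic exercises*, J. Amer. Math. Soc. 14 (2001), 843–939: Thm. B
  (p. 843) = Thm. 2.2.1 (§2.2), Introduction p. 845 ("Serre has conjectured that all odd,
  irreducible `ρ̄` are strongly modular [Se2]"), Thm. 2.2.2.
* [Serre1987] J.-P. Serre, *Sur les représentations modulaires de degré `2` de `Gal(ℚ̄/ℚ)`*,
  Duke Math. J. 54 (1987), §1.1 (odd), §1.4 (`χ̄`), (3.2.3) (weak conjecture).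
* [KhareWintenberger2009] C. Khare, J.-P. Wintenberger, *Serre's modularity conjecture (I)*,
  Invent. Math. 178 (2009), 485–504, Thm. 1.2.
* [ConradDiamondTaylor1999] B. Conrad, F. Diamond, R. Taylor, J. Amer. Math. Soc. 12 (1999),
  Thms. 7.1.2, 7.2.2, 7.2.4.

## Design

Pure theorems; `noncomputable section`; no instances (the discrete topology on
`AlgebraicClosure (ZMod 5)` is a local `letI`), no `sorry`. Axioms: `propext`, `Classical.choice`,
`Quot.sound`.
-/

noncomputable section

open scoped MatrixGroups
open Field CongruenceSubgroup

universe u v w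

/-! ## Bookkeeping: oddness and irreducibility under base change -/

namespace Literature.NumberTheory.GaloisRepresentations

/-- Oddness is preserved by base change along any continuous ring homomorphism `f : A →+* B`:
`det (ρ ⊗ B)(c) = f(det ρ(c)) = f(-1) = -1`. Deliberate dot-notation extension of
`FramedGaloisRep.IsOdd` (file `GaloisRep`) declared from `NumberTheory/Automorphic`. [folklore] -/
theorem FramedGaloisRep.IsOdd.baseChange {K : Type u} [Field K] {A : Type v} [CommRing A]
    [TopologicalSpace A] {B : Type w} [CommRing B] [TopologicalSpace B] {n : ℕ}
    {ρ : FramedGaloisRep K A n} (h : FramedGaloisRep.IsOdd ρ) (f : A →+* B) (hf : Continuous f) :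
    FramedGaloisRep.IsOdd (FramedRep.baseChange f hf ρ) := by
  intro φ c hc
  rw [FramedRep.baseChange_apply, Matrix.GeneralLinearGroup.map_det, h φ c hc]
  ext
  simp

/-- An absolutely irreducible framed representation over a field `A` stays irreducible after base
change to any field `B` (in the universe of `A`) along a continuous `f : A →+* B`: this is the
definition of `FramedRep.IsAbsolutelyIrreducible`, transported along
`FramedRep.toRepresentation_baseChange`. Deliberate dot-notation extension (file `ContinuousRep`).
[folklore] -/
theorem FramedRep.IsAbsolutelyIrreducible.isIrreducible_baseChange {G : Type u} [Group G]
    [TopologicalSpace G] {A : Type v} [Field A] [TopologicalSpace A] {n : ℕ} {ρ : FramedRep G A n}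
    (h : ρ.IsAbsolutelyIrreducible) (B : Type v) [Field B] [TopologicalSpace B] (f : A →+* B)
    (hf : Continuous f) : (FramedRep.baseChange f hf ρ).IsIrreducible := by
  change (FramedRep.baseChange f hf ρ).toRepresentation.IsIrreducible
  rw [FramedRep.toRepresentation_baseChange]
  exact h B f

/-- **Cyclotomic determinant ⇒ odd.** A mod-`p` representation `ρ̄ : Γ_K →ₜ* GL_n(𝔽_p)`
(`p ≠ char K`) whose determinant is the mod-`p` cyclotomic character `χ̄_p`
(`modPCyclotomicCharacterZMod`) is odd: for a complex conjugation `c`, `χ̄_p(c) = -1` because `c`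
inverts roots of unity (`modNCyclotomicCharacter_of_isComplexConjugation`). (Serre, Duke Math. J.
54 (1987), §1.1 and §1.4; BCDT, Introduction: "`ρ_{f,λ}` is odd in the sense that `det ρ` of
complex conjugation is `-1`".) Deliberate dot-notation extension of `ModPGaloisRep`.
[cite: Serre1987, §1.1 and §1.4] -/
theorem ModPGaloisRep.isOdd_of_det_eq_modPCyclotomicCharacterZMod {K : Type u} [Field K]
    {p : ℕ} [Fact p.Prime] [NeZero (p : K)] {n : ℕ} (ρ : ModPGaloisRep K (ZMod p) n)
    (hdet : ∀ σ : absoluteGaloisGroup K,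
      Matrix.GeneralLinearGroup.det (ρ σ) = modPCyclotomicCharacterZMod K p σ) :
    FramedGaloisRep.IsOdd ρ := by
  intro φ c hc
  rw [hdet c]
  ext
  rw [modPCyclotomicCharacterZMod_eq_modNCyclotomicCharacter,
    modNCyclotomicCharacter_of_isComplexConjugation hc, Units.val_neg, Units.val_one]

end Literature.NumberTheory.GaloisRepresentations

/-! ## Theorem B from Serre's conjecture (3.2.3) at `p = 5` -/

namespace Literature.NumberTheory.Automorphic.BCDT

open GaloisRepresentations EllipticCurves.ModularForms

/-- **BCDT Theorem B is a case of Serre's conjecture (3.2.3) (Khare–Wintenberger).** If every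
continuous, irreducible, odd `ρ̄ : Γ_ℚ → GL₂(k)`, `k` algebraically closed of characteristic `5`
with the discrete topology, arises from a newform — the tree's named fact
`exists_newform_of_odd_irreducible` (Serre, Duke Math. J. 54 (1987), (3.2.3); Khare–Wintenberger,
Invent. Math. 178 (2009), Thm. 1.2) at `p = 5`, for every such `k : Type` — then every continuous
absolutely irreducible `ρ̄ : G_ℚ → GL₂(𝔽₅)` with cyclotomic determinant is modular
(`BCDT.theoremB`; Breuil–Conrad–Diamond–Taylor 2001, Thm. B = Thm. 2.2.1). Indeed `ρ̄ ⊗ 𝔽̄₅` is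
irreducible (absolute irreducibility) and odd (`det ρ̄(c) = χ̄₅(c) = -1`), so (3.2.3) yields a
newform `f ∈ S_w(Γ₁(N))` and `ι : 𝓞_f → 𝔽̄₅` with `ρ̄ ⊗ 𝔽̄₅` unramified at `q ∤ 5N` and
`charpoly (ρ̄ ⊗ 𝔽̄₅)(Frob_q) = ι(X² - a_q(f) X + ε(q) q^{w-1})`, which is BCDT's "`ρ̄` is modular"
(`ModPGaloisRep.IsModular`, with `K = 𝔽̄₅`, `j = algebraMap`); `w ≥ 1` since `S₀(Γ₁(N)) = 0`
while a newform is non-zero. (BCDT, Introduction, p. 845: "Serre has conjectured that all odd,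
irreducible `ρ̄` are strongly modular [Se2]".)
[cite: BCDTJAMS2001, Theorem B (= Thm. 2.2.1) and Introduction p. 845] -/
theorem theoremB_of_exists_newform_of_odd_irreducible
    (hSerre : ∀ (k : Type) [Field k] [TopologicalSpace k] [DiscreteTopology k],
      exists_newform_of_odd_irreducible (p := 5) (k := k)) :
    theoremB := by
  intro ρ habs hdet
  -- coefficient field `𝔽̄₅` with the discrete topology
  letI : TopologicalSpace (AlgebraicClosure (ZMod 5)) := ⊥
  haveI : DiscreteTopology (AlgebraicClosure (ZMod 5)) := ⟨rfl⟩
  set j : ZMod 5 →+* AlgebraicClosure (ZMod 5) := algebraMap (ZMod 5) (AlgebraicClosure (ZMod 5))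
    with hj
  set ρ' : ModPGaloisRep ℚ (AlgebraicClosure (ZMod 5)) 2 :=
    FramedRep.baseChange j continuous_of_discreteTopology ρ with hρ'
  have hirr : ρ'.toGaloisRep.IsIrreducible := by
    rw [← ModPGaloisRep.isIrreducible_iff_toGaloisRep]
    exact habs.isIrreducible_baseChange (AlgebraicClosure (ZMod 5)) j _
  have hodd : FramedGaloisRep.IsOdd ρ' :=
    (ModPGaloisRep.isOdd_of_det_eq_modPCyclotomicCharacterZMod ρ hdet).baseChange j _
  obtain ⟨N, hN, w, f, ι, hnew, hgal⟩ := hSerre (AlgebraicClosure (ZMod 5)) ρ' hirr hodd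
  -- the weight is positive: a newform is non-zero, and `S_w(Γ₁(N)) = 0` for `w ≤ 0`
  have hw : (1 : ℤ) ≤ (w : ℤ) := by
    rcases Nat.eq_zero_or_pos w with h0 | hpos
    · subst h0
      exact absurd (cuspForm_eq_zero_of_weight_nonpos (le_of_eq (by simp)) f) hnew.2.2.2.ne_zero
    · exact_mod_cast hpos
  refine ⟨N, hN, (w : ℤ), f, AlgebraicClosure (ZMod 5), inferInstance, ⊥, ⟨rfl⟩, j, ι, hw, hnew,
    ?_⟩
  rw [ZMod.ringChar_zmod_n]
  exact hgal

/-! ## Theorem A and **lang.S33** from Serre (3.2.3) at `p = 5` and Conrad–Diamond–Taylor -/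

/-- **Theorem A from Serre's conjecture (3.2.3) at `p = 5` and CDT Thm. 7.2.4.** Granted the
tree's named facts `exists_newform_of_odd_irreducible` at `p = 5` (Serre (3.2.3);
Khare–Wintenberger 2009, Thm. 1.2) and `CDT_theorem_7_2_4` (Conrad–Diamond–Taylor 1999,
Thm. 7.2.4), every elliptic curve over `ℚ` is modular
(`Literature.NumberTheory.EllipticCurves.ModularForms.exists_isNewformOf`): Theorem B by
`theoremB_of_exists_newform_of_odd_irreducible`, then BCDT Thm. 2.2.2 as assembled in
`exists_isNewformOf_of_theoremB_of_CDT` (Weil pairing proved). Alternative trust base of the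
Modularity Theorem in the tree: {Serre (3.2.3) at `p = 5`, CDT Thm. 7.2.4}.
[cite: BCDTJAMS2001, Theorem 2.2.2] -/
theorem exists_isNewformOf_of_serre_of_CDT
    (hSerre : ∀ (k : Type) [Field k] [TopologicalSpace k] [DiscreteTopology k],
      exists_newform_of_odd_irreducible (p := 5) (k := k))
    (hCDT : CDT_theorem_7_2_4) : EllipticCurves.ModularForms.exists_isNewformOf :=
  exists_isNewformOf_of_theoremB_of_CDT (theoremB_of_exists_newform_of_odd_irreducible hSerre) hCDT

/-- **Theorem A from Serre (3.2.3) at `p = 5`, CDT Thms. 7.1.2 and 7.2.2, and Ogg–Saito for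
`V₅ E`** (CDT Thm. 7.2.4 replaced by its printed inputs, `CDT_theorem_7_2_4_of_7_1_2_of_7_2_2`,
file `CDTModularityProofs`). Trust base: {Serre (3.2.3) at `p = 5`, CDT Thm. 7.1.2, CDT Thm. 7.2.2,
`WeierstrassCurve.artinConductorExponent_tate_eq_conductorExponent_of_isElliptic · 5`}.
[cite: BCDTJAMS2001, Theorem 2.2.2] -/
theorem exists_isNewformOf_of_serre_of_CDT712_722
    (hSerre : ∀ (k : Type) [Field k] [TopologicalSpace k] [DiscreteTopology k],
      exists_newform_of_odd_irreducible (p := 5) (k := k))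
    (h712 : CDT_theorem_7_1_2) (h722 : CDT_theorem_7_2_2)
    (hOgg : ∀ W : WeierstrassCurve ℚ,
      W.artinConductorExponent_tate_eq_conductorExponent_of_isElliptic 5) :
    EllipticCurves.ModularForms.exists_isNewformOf :=
  exists_isNewformOf_of_theoremB_of_CDT712_722
    (theoremB_of_exists_newform_of_odd_irreducible hSerre) h712 h722 hOgg

end Literature.NumberTheory.Automorphic.BCDT

namespace Literature.NumberTheory.Automorphic

open BCDT

/-- **lang.S33 (`a_p`-form) from Serre's conjecture (3.2.3) at `p = 5` and CDT Thm. 7.2.4**: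
every integral Weierstrass equation `E` over `ℤ` with `Δ_E ≠ 0` has a level `N ≥ 1` and a cusp
form `f ∈ S₂(Γ₀(N))` with `a_p(f) = p + 1 - #E(𝔽_p)` for all primes `p ∤ N Δ_E`
(`exists_cuspForm_coeff_eq_frobeniusTrace`), from the named facts
`exists_newform_of_odd_irreducible` (at `p = 5`) and `CDT_theorem_7_2_4`, via Theorem A
(`exists_isNewformOf_of_serre_of_CDT`) and the glue step of
`exists_cuspForm_coeff_eq_frobeniusTrace_of_exists_isNewformOf` (`LangWave0Proofs`, Part 2).
[cite: BCDTJAMS2001, Theorem A and Theorem 2.2.2] -/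
theorem exists_cuspForm_coeff_eq_frobeniusTrace_of_serre_of_CDT
    (hSerre : ∀ (k : Type) [Field k] [TopologicalSpace k] [DiscreteTopology k],
      exists_newform_of_odd_irreducible (p := 5) (k := k))
    (hCDT : CDT_theorem_7_2_4) : exists_cuspForm_coeff_eq_frobeniusTrace :=
  exists_cuspForm_coeff_eq_frobeniusTrace_of_exists_isNewformOf
    (exists_isNewformOf_of_serre_of_CDT hSerre hCDT)

/-- **lang.S33 (`L`-series form) from Serre's conjecture (3.2.3) at `p = 5` and CDT Thm. 7.2.4**
(`exists_cuspForm_qExpansion_coeff_eq_lFunction`), via Theorem A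
(`exists_isNewformOf_of_serre_of_CDT`) and `LangWave0Proofs`, Part 3.
[cite: BCDTJAMS2001, Theorem A and Theorem 2.2.2] -/
theorem exists_cuspForm_qExpansion_coeff_eq_lFunction_of_serre_of_CDT
    (hSerre : ∀ (k : Type) [Field k] [TopologicalSpace k] [DiscreteTopology k],
      exists_newform_of_odd_irreducible (p := 5) (k := k))
    (hCDT : CDT_theorem_7_2_4) : exists_cuspForm_qExpansion_coeff_eq_lFunction :=
  exists_cuspForm_qExpansion_coeff_eq_lFunction_of_exists_isNewformOf
    (exists_isNewformOf_of_serre_of_CDT hSerre hCDT)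

end Literature.NumberTheory.Automorphic

end
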